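import Summits.CriticalPhenomena.PercolationContinuityZ3.Theorems.PercNearOneGluingNoHeavyLowerTailForestRayleighPosCorr
import Summits.CriticalPhenomena.PercolationContinuityZ3.Theorems.PercNearOneGluingNoHeavyLowerTailForestRayleighCounting
import HarnessLib

/-!
# Weighted forest negative correlation — consequences of the Rayleigh property of an edge system

Notation as in `…ForestRayleighTools`: `Z(D;K) = Σ_{G ⊆ D, ⟨G ∪ K⟩ acyclic} ∏ w`. Say a loop-free
edge system `T ⊆ Sym2 V` has the *Rayleigh property* if `(R)(D;K;e,f)`,
`Z(D;K∪{e,f})·Z(D;K) ≤ Z(D;K∪e)·Z(D;K∪f)`, holds for all activities `w ≥ 0` and every instance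
inside `T` (written out as a hypothesis; no definition is introduced). This file derives from it,
uniformly in `T`:

* `forestsW_connMonotone_of_rayleigh`: connection probabilities of the arboreal gas on every minor of
  `T` are nondecreasing under pinning (`a = b` or `ab ∈ T`);
* `forestsW_conn_posCorr_of_rayleigh`: **positive correlation of connection events** (memo
  KCLUSTER-gen86 Theorem A) `Z[a~b]·Z[c~d] ≤ Z·Z[a~b ∧ c~d]` on every minor of `T`, all activities;
* `forests_negCorr_of_rayleigh`: the Grimmett–Winkler / Kahn counting inequality
  `#{e,f ∈ F}·#F ≤ #{e ∈ F}·#{f ∈ F}` for uniform forests of every `E ⊆ T`.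

These are the proofs of `…ForestRayleighPosCorr` / `…Counting` with the tree-width-2 theorem
replaced by the abstract hypothesis, so that they apply verbatim to `K₄` (`…KFour`), to 2-sums
(`…TwoSum`) and to any future member of the class. Theorems only; no definitions, no `sorry`.
-/

open Finset SimpleGraph
open scoped Classical

namespace Summit.CriticalPhenomena.PercolationContinuityZ3.Theorems.ForestRayleigh

variable {V : Type*} [Fintype V] [DecidableEq V]

/-- **Connection probabilities are nondecreasing under pinning, on a Rayleigh system.** For a
loop-free `T` with the Rayleigh property, `w ≥ 0`, disjoint `D, K`, `f ∉ D ∪ K`, `D ∪ K ∪ f ⊆ T`,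
and `a = b` or `ab ∈ T`: `Z(D;K)[a~b]·Z(D;K∪f) ≤ Z(D;K∪f)[a~b]·Z(D;K)`.
[from `(R)` via `Z[a≁b] = Z(·;· ∪ ab)`; cf. `forestsW_connMonotone_of_elimOrder`] -/
theorem forestsW_connMonotone_of_rayleigh (T : Finset (Sym2 V)) (hT : ∀ x ∈ T, ¬x.IsDiag)
    (hR : ∀ (w : Sym2 V → ℝ), (∀ x, 0 ≤ w x) → ∀ (D K : Finset (Sym2 V)) (e f : Sym2 V),
      D ∪ insert e (insert f K) ⊆ T → Disjoint D K → e ∉ D → e ∉ K → f ∉ D →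
      f ∉ K → e ≠ f →
      (∑ G ∈ D.powerset.filter (fun G =>
        (fromEdgeSet ((G ∪ (insert e (insert f (K))) : Finset (Sym2 V)) : Set (Sym2 V))).IsAcyclic), ∏ x ∈ G, w x) *
        (∑ G ∈ D.powerset.filter (fun G =>
        (fromEdgeSet ((G ∪ (K) : Finset (Sym2 V)) : Set (Sym2 V))).IsAcyclic), ∏ x ∈ G, w x) ≤
      (∑ G ∈ D.powerset.filter (fun G =>
        (fromEdgeSet ((G ∪ (insert e (K)) : Finset (Sym2 V)) : Set (Sym2 V))).IsAcyclic), ∏ x ∈ G, w x) *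
        (∑ G ∈ D.powerset.filter (fun G =>
        (fromEdgeSet ((G ∪ (insert f (K)) : Finset (Sym2 V)) : Set (Sym2 V))).IsAcyclic), ∏ x ∈ G, w x))
    (w : Sym2 V → ℝ) (hw : ∀ x, 0 ≤ w x) (D K : Finset (Sym2 V)) (f : Sym2 V) {a b : V}
    (hab : a = b ∨ s(a, b) ∈ T) (hfD : f ∉ D) (hfK : f ∉ K) (hDK : Disjoint D K)
    (hsub : D ∪ insert f K ⊆ T) :
    (∑ G ∈ D.powerset.filter (fun G =>
        (fromEdgeSet ((G ∪ K : Finset (Sym2 V)) : Set (Sym2 V))).IsAcyclic ∧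
        (fromEdgeSet ((G ∪ K : Finset (Sym2 V)) : Set (Sym2 V))).Reachable a b), ∏ x ∈ G, w x) *
      (∑ G ∈ D.powerset.filter (fun G =>
        (fromEdgeSet ((G ∪ (insert f K) : Finset (Sym2 V)) : Set (Sym2 V))).IsAcyclic), ∏ x ∈ G, w x) ≤
    (∑ G ∈ D.powerset.filter (fun G =>
        (fromEdgeSet ((G ∪ (insert f K) : Finset (Sym2 V)) : Set (Sym2 V))).IsAcyclic ∧
        (fromEdgeSet ((G ∪ (insert f K) : Finset (Sym2 V)) : Set (Sym2 V))).Reachable a b), ∏ x ∈ G, w x) *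
      (∑ G ∈ D.powerset.filter (fun G =>
        (fromEdgeSet ((G ∪ K : Finset (Sym2 V)) : Set (Sym2 V))).IsAcyclic), ∏ x ∈ G, w x) := by
  have hE : ∀ x ∈ D ∪ insert f K, ¬x.IsDiag := fun x hx => hT x (hsub hx)
  have hE₀ : ∀ x ∈ D ∪ K, ¬x.IsDiag := fun x hx =>
    hE x (Finset.union_subset_union subset_rfl (Finset.subset_insert _ _) hx)
  rcases eq_or_ne a b with rfl | hne
  · rw [forestsW_conn_eq_of_forall w D K (fun G _ => Reachable.refl _),
      forestsW_conn_eq_of_forall w D (insert f K) (fun G _ => Reachable.refl _), mul_comm]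
  have hgT : s(a, b) ∈ T := hab.resolve_left hne
  by_cases hgK : s(a, b) ∈ K
  · have hr : ∀ K' : Finset (Sym2 V), K ⊆ K' → ∀ G : Finset (Sym2 V), G ⊆ D →
        (fromEdgeSet ((G ∪ K' : Finset (Sym2 V)) : Set (Sym2 V))).Reachable a b :=
      fun K' hK' G _ => Adj.reachable ((fromEdgeSet_adj _).2
        ⟨Finset.mem_coe.2 (Finset.mem_union_right _ (hK' hgK)), hne⟩)
    rw [forestsW_conn_eq_of_forall w D K (hr K subset_rfl),
      forestsW_conn_eq_of_forall w D (insert f K) (hr _ (Finset.subset_insert _ _)), mul_comm]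
  by_cases hgf : s(a, b) = f
  · have hr : ∀ G : Finset (Sym2 V), G ⊆ D →
        (fromEdgeSet ((G ∪ insert f K : Finset (Sym2 V)) : Set (Sym2 V))).Reachable a b :=
      fun G _ => Adj.reachable ((fromEdgeSet_adj _).2
        ⟨Finset.mem_coe.2 (Finset.mem_union_right _ (hgf ▸ Finset.mem_insert_self _ _)), hne⟩)
    rw [forestsW_conn_eq_of_forall w D (insert f K) hr, mul_comm]
    exact mul_le_mul_of_nonneg_left
      (ConnMonotone.sum_pinned_filter_le w hw
        (fun X : Finset (Sym2 V) => (fromEdgeSet ((X : Finset (Sym2 V)) : Set (Sym2 V))).IsAcyclic)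
        (fun X : Finset (Sym2 V) => (fromEdgeSet ((X : Finset (Sym2 V)) : Set (Sym2 V))).Reachable a b) D K)
      (forestsW_nonneg w hw _ _)
  by_cases hgD : s(a, b) ∈ D
  · -- the free copy of `ab` splits off; Rayleigh for `(D ∖ ab; K; ab, f)`
    have hD' : D = insert s(a, b) (D.erase s(a, b)) := (Finset.insert_erase hgD).symm
    have hg₀ : s(a, b) ∉ D.erase s(a, b) := Finset.notMem_erase _ _
    have sD : D.erase s(a, b) ⊆ D := Finset.erase_subset _ _
    have ray := hR w hw (D.erase s(a, b)) K s(a, b) f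
      (by
        rw [Finset.union_insert]
        exact Finset.insert_subset hgT ((Finset.union_subset_union sD subset_rfl).trans hsub))
      (Finset.disjoint_of_subset_left sD hDK)
      hg₀ hgK (fun hh => hfD (sD hh)) hfK hgf
    have hr : ∀ K' : Finset (Sym2 V), ∀ G : Finset (Sym2 V), G ⊆ D.erase s(a, b) →
        (fromEdgeSet ((G ∪ insert s(a, b) K' : Finset (Sym2 V)) : Set (Sym2 V))).Reachable a b :=
      fun K' G _ => Adj.reachable ((fromEdgeSet_adj _).2
        ⟨Finset.mem_coe.2 (Finset.mem_union_right _ (Finset.mem_insert_self _ _)), hne⟩)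
    have nd₁ : ∀ x ∈ D.erase s(a, b) ∪ K, ¬x.IsDiag := fun x hx =>
      hE₀ x (Finset.union_subset_union sD subset_rfl hx)
    have nd₂ : ∀ x ∈ D.erase s(a, b) ∪ insert f K, ¬x.IsDiag := fun x hx =>
      hE x (Finset.union_subset_union sD subset_rfl hx)
    have hA := forestsW_conn_add_pin w (D.erase s(a, b)) K nd₁ hne (by
      rw [Finset.mem_union, not_or]; exact ⟨hg₀, hgK⟩)
    have hC := forestsW_conn_add_pin w (D.erase s(a, b)) (insert f K) nd₂ hne (by
      rw [Finset.mem_union, Finset.mem_insert, not_or, not_or]; exact ⟨hg₀, hgf, hgK⟩)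
    rw [hD', sum_pinned_insert_split w (fun X : Finset (Sym2 V) =>
        (fromEdgeSet ((X : Finset (Sym2 V)) : Set (Sym2 V))).IsAcyclic ∧
        (fromEdgeSet ((X : Finset (Sym2 V)) : Set (Sym2 V))).Reachable a b) _ K hg₀,
      sum_pinned_insert_split w (fun X : Finset (Sym2 V) =>
        (fromEdgeSet ((X : Finset (Sym2 V)) : Set (Sym2 V))).IsAcyclic ∧
        (fromEdgeSet ((X : Finset (Sym2 V)) : Set (Sym2 V))).Reachable a b) _ (insert f K) hg₀,
      forestsW_insert_split w _ K hg₀, forestsW_insert_split w _ (insert f K) hg₀,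
      forestsW_conn_eq_of_forall w _ (insert s(a, b) K) (hr K),
      forestsW_conn_eq_of_forall w _ (insert s(a, b) (insert f K)) (hr (insert f K))]
    exact real_mono_of_rayleigh_free hA hC ray
  · -- `ab` is a new edge; Rayleigh for `(D; K; ab, f)`
    have ray := hR w hw D K s(a, b) f
      (by
        rw [Finset.union_insert]
        exact Finset.insert_subset hgT hsub) hDK hgD hgK hfD hfK hgf
    have hA := forestsW_conn_add_pin w D K hE₀ hne (by
      rw [Finset.mem_union, not_or]; exact ⟨hgD, hgK⟩)
    have hC := forestsW_conn_add_pin w D (insert f K) hE hne (by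
      rw [Finset.mem_union, Finset.mem_insert, not_or, not_or]; exact ⟨hgD, hgf, hgK⟩)
    exact real_mono_of_rayleigh hA hC ray

/-- **Positive correlation of connection events in the arboreal gas on a Rayleigh system**
(Theorem A of memo KCLUSTER-gen86, all activities): for loop-free `T` with the Rayleigh property,
`w ≥ 0`, disjoint `D ∪ K ⊆ T`, and `ab, cd ∈ T` (or trivial pairs),
`Z(D;K)[a~b]·Z(D;K)[c~d] ≤ Z(D;K)·Z(D;K)[a~b ∧ c~d]`. [NC ⟹ AG-PC; Harris-type induction] -/
theorem forestsW_conn_posCorr_of_rayleigh (T : Finset (Sym2 V)) (hT : ∀ x ∈ T, ¬x.IsDiag)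
    (hR : ∀ (w : Sym2 V → ℝ), (∀ x, 0 ≤ w x) → ∀ (D K : Finset (Sym2 V)) (e f : Sym2 V),
      D ∪ insert e (insert f K) ⊆ T → Disjoint D K → e ∉ D → e ∉ K → f ∉ D →
      f ∉ K → e ≠ f →
      (∑ G ∈ D.powerset.filter (fun G =>
        (fromEdgeSet ((G ∪ (insert e (insert f (K))) : Finset (Sym2 V)) : Set (Sym2 V))).IsAcyclic), ∏ x ∈ G, w x) *
        (∑ G ∈ D.powerset.filter (fun G =>
        (fromEdgeSet ((G ∪ (K) : Finset (Sym2 V)) : Set (Sym2 V))).IsAcyclic), ∏ x ∈ G, w x) ≤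
      (∑ G ∈ D.powerset.filter (fun G =>
        (fromEdgeSet ((G ∪ (insert e (K)) : Finset (Sym2 V)) : Set (Sym2 V))).IsAcyclic), ∏ x ∈ G, w x) *
        (∑ G ∈ D.powerset.filter (fun G =>
        (fromEdgeSet ((G ∪ (insert f (K)) : Finset (Sym2 V)) : Set (Sym2 V))).IsAcyclic), ∏ x ∈ G, w x))
    (w : Sym2 V → ℝ) (hw : ∀ x, 0 ≤ w x) (D K : Finset (Sym2 V)) (hDK : Disjoint D K)
    (hsub : D ∪ K ⊆ T) {a b c d : V} (hab : a = b ∨ s(a, b) ∈ T) (hcd : c = d ∨ s(c, d) ∈ T) :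
    (∑ G ∈ D.powerset.filter (fun G =>
        (fromEdgeSet ((G ∪ K : Finset (Sym2 V)) : Set (Sym2 V))).IsAcyclic ∧
        (fromEdgeSet ((G ∪ K : Finset (Sym2 V)) : Set (Sym2 V))).Reachable a b), ∏ x ∈ G, w x) *
      (∑ G ∈ D.powerset.filter (fun G =>
        (fromEdgeSet ((G ∪ K : Finset (Sym2 V)) : Set (Sym2 V))).IsAcyclic ∧
        (fromEdgeSet ((G ∪ K : Finset (Sym2 V)) : Set (Sym2 V))).Reachable c d), ∏ x ∈ G, w x) ≤
    (∑ G ∈ D.powerset.filter (fun G =>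
        (fromEdgeSet ((G ∪ K : Finset (Sym2 V)) : Set (Sym2 V))).IsAcyclic), ∏ x ∈ G, w x) *
      (∑ G ∈ D.powerset.filter (fun G =>
        (fromEdgeSet ((G ∪ K : Finset (Sym2 V)) : Set (Sym2 V))).IsAcyclic ∧
        ((fromEdgeSet ((G ∪ K : Finset (Sym2 V)) : Set (Sym2 V))).Reachable a b ∧
         (fromEdgeSet ((G ∪ K : Finset (Sym2 V)) : Set (Sym2 V))).Reachable c d)), ∏ x ∈ G, w x) :=
  sum_mul_sum_inter_ge_of_monotone_on_disjoint w hw T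
    (fun X => (fromEdgeSet ((X : Finset (Sym2 V)) : Set (Sym2 V))).IsAcyclic)
    (fun X => (fromEdgeSet ((X : Finset (Sym2 V)) : Set (Sym2 V))).Reachable a b)
    (fun X => (fromEdgeSet ((X : Finset (Sym2 V)) : Set (Sym2 V))).Reachable c d)
    (fun D K f hfD hfK hdis hE => forestsW_connMonotone_of_rayleigh T hT hR w hw D K f hab
      hfD hfK hdis hE)
    (fun D K f hfD hfK hdis hE => forestsW_connMonotone_of_rayleigh T hT hR w hw D K f hcd
      hfD hfK hdis hE)
    D K hDK hsub

omit [Fintype V] in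
/-- **Grimmett–Winkler / Kahn negative correlation for uniform forests of a Rayleigh system**
(counting form): for `E ⊆ T` and edges `e ≠ f` of `E`,
`#{F : e,f ∈ F}·#{F} ≤ #{F : e ∈ F}·#{F : f ∈ F}` over the forests `F ⊆ E`.
[unit-weight case of `(R)`; cf. `forests_negCorr_of_elimOrder`] -/
theorem forests_negCorr_of_rayleigh (T : Finset (Sym2 V))
    (hR : ∀ (w : Sym2 V → ℝ), (∀ x, 0 ≤ w x) → ∀ (D K : Finset (Sym2 V)) (e f : Sym2 V),
      D ∪ insert e (insert f K) ⊆ T → Disjoint D K → e ∉ D → e ∉ K → f ∉ D →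
      f ∉ K → e ≠ f →
      (∑ G ∈ D.powerset.filter (fun G =>
        (fromEdgeSet ((G ∪ (insert e (insert f (K))) : Finset (Sym2 V)) : Set (Sym2 V))).IsAcyclic), ∏ x ∈ G, w x) *
        (∑ G ∈ D.powerset.filter (fun G =>
        (fromEdgeSet ((G ∪ (K) : Finset (Sym2 V)) : Set (Sym2 V))).IsAcyclic), ∏ x ∈ G, w x) ≤
      (∑ G ∈ D.powerset.filter (fun G =>
        (fromEdgeSet ((G ∪ (insert e (K)) : Finset (Sym2 V)) : Set (Sym2 V))).IsAcyclic), ∏ x ∈ G, w x) *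
        (∑ G ∈ D.powerset.filter (fun G =>
        (fromEdgeSet ((G ∪ (insert f (K)) : Finset (Sym2 V)) : Set (Sym2 V))).IsAcyclic), ∏ x ∈ G, w x))
    (E : Finset (Sym2 V)) (hE : E ⊆ T) {e f : Sym2 V} (he : e ∈ E) (hf : f ∈ E) (hef : e ≠ f) :
    #(E.powerset.filter fun F : Finset (Sym2 V) =>
        (fromEdgeSet ((F : Finset (Sym2 V)) : Set (Sym2 V))).IsAcyclic ∧ e ∈ F ∧ f ∈ F) *
      #(E.powerset.filter fun F : Finset (Sym2 V) =>
        (fromEdgeSet ((F : Finset (Sym2 V)) : Set (Sym2 V))).IsAcyclic) ≤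
    #(E.powerset.filter fun F : Finset (Sym2 V) =>
        (fromEdgeSet ((F : Finset (Sym2 V)) : Set (Sym2 V))).IsAcyclic ∧ e ∈ F) *
      #(E.powerset.filter fun F : Finset (Sym2 V) =>
        (fromEdgeSet ((F : Finset (Sym2 V)) : Set (Sym2 V))).IsAcyclic ∧ f ∈ F) := by
  -- the four counts over `D = E ∖ {e, f}`
  have hfe : f ∈ E.erase e := Finset.mem_erase.2 ⟨hef.symm, hf⟩
  have heD : e ∉ (E.erase e).erase f := fun hh => Finset.notMem_erase e E (Finset.mem_of_mem_erase hh)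
  have hfD : f ∉ (E.erase e).erase f := Finset.notMem_erase _ _
  -- N_ef
  have nef : #(E.powerset.filter fun F : Finset (Sym2 V) =>
        (fromEdgeSet ((F : Finset (Sym2 V)) : Set (Sym2 V))).IsAcyclic ∧ e ∈ F ∧ f ∈ F) =
      #(((E.erase e).erase f).powerset.filter fun G : Finset (Sym2 V) =>
        (fromEdgeSet ((insert e (insert f G) : Finset (Sym2 V)) : Set (Sym2 V))).IsAcyclic) := by
    have c₁ : (E.powerset.filter fun F : Finset (Sym2 V) => (fromEdgeSet ((F : Finset (Sym2 V)) : Set (Sym2 V))).IsAcyclic ∧ e ∈ F ∧ f ∈ F) =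
        E.powerset.filter fun F : Finset (Sym2 V) => ((fromEdgeSet ((F : Finset (Sym2 V)) : Set (Sym2 V))).IsAcyclic ∧ f ∈ F) ∧ e ∈ F :=
      Finset.filter_congr fun F _ => ⟨fun hh => ⟨⟨hh.1, hh.2.2⟩, hh.2.1⟩, fun hh => ⟨hh.1.1, hh.2, hh.1.2⟩⟩
    rw [c₁, card_filter_and_mem (fun F : Finset (Sym2 V) => (fromEdgeSet ((F : Finset (Sym2 V)) : Set (Sym2 V))).IsAcyclic ∧ f ∈ F) E he]
    have c₂ : ((E.erase e).powerset.filter fun G : Finset (Sym2 V) =>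
        (fromEdgeSet ((insert e G : Finset (Sym2 V)) : Set (Sym2 V))).IsAcyclic ∧ f ∈ insert e G) =
        (E.erase e).powerset.filter fun G : Finset (Sym2 V) =>
          (fromEdgeSet ((insert e G : Finset (Sym2 V)) : Set (Sym2 V))).IsAcyclic ∧ f ∈ G :=
      Finset.filter_congr fun G _ => by
        rw [Finset.mem_insert, or_iff_right hef.symm]
    rw [c₂, card_filter_and_mem (fun G : Finset (Sym2 V) =>
      (fromEdgeSet ((insert e G : Finset (Sym2 V)) : Set (Sym2 V))).IsAcyclic) (E.erase e) hfe]
  -- N_e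
  have ne : #(E.powerset.filter fun F : Finset (Sym2 V) =>
        (fromEdgeSet ((F : Finset (Sym2 V)) : Set (Sym2 V))).IsAcyclic ∧ e ∈ F) =
      #(((E.erase e).erase f).powerset.filter fun G : Finset (Sym2 V) =>
        (fromEdgeSet ((insert e (insert f G) : Finset (Sym2 V)) : Set (Sym2 V))).IsAcyclic) +
      #(((E.erase e).erase f).powerset.filter fun G : Finset (Sym2 V) =>
        (fromEdgeSet ((insert e G : Finset (Sym2 V)) : Set (Sym2 V))).IsAcyclic) := by
    rw [card_filter_and_mem (fun F : Finset (Sym2 V) => (fromEdgeSet ((F : Finset (Sym2 V)) : Set (Sym2 V))).IsAcyclic) E he,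
      card_filter_split_mem _ (E.erase e) f,
      card_filter_and_mem (fun G : Finset (Sym2 V) =>
        (fromEdgeSet ((insert e G : Finset (Sym2 V)) : Set (Sym2 V))).IsAcyclic) (E.erase e) hfe,
      card_filter_and_not_mem (fun G : Finset (Sym2 V) =>
        (fromEdgeSet ((insert e G : Finset (Sym2 V)) : Set (Sym2 V))).IsAcyclic) (E.erase e) f]
  -- N_f
  have hef' : e ∈ E.erase f := Finset.mem_erase.2 ⟨hef, he⟩
  have hDD : (E.erase f).erase e = (E.erase e).erase f := Finset.erase_right_comm
  have nf : #(E.powerset.filter fun F : Finset (Sym2 V) =>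
        (fromEdgeSet ((F : Finset (Sym2 V)) : Set (Sym2 V))).IsAcyclic ∧ f ∈ F) =
      #(((E.erase e).erase f).powerset.filter fun G : Finset (Sym2 V) =>
        (fromEdgeSet ((insert e (insert f G) : Finset (Sym2 V)) : Set (Sym2 V))).IsAcyclic) +
      #(((E.erase e).erase f).powerset.filter fun G : Finset (Sym2 V) =>
        (fromEdgeSet ((insert f G : Finset (Sym2 V)) : Set (Sym2 V))).IsAcyclic) := by
    rw [card_filter_and_mem (fun F : Finset (Sym2 V) => (fromEdgeSet ((F : Finset (Sym2 V)) : Set (Sym2 V))).IsAcyclic) E hf,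
      card_filter_split_mem _ (E.erase f) e,
      card_filter_and_mem (fun G : Finset (Sym2 V) =>
        (fromEdgeSet ((insert f G : Finset (Sym2 V)) : Set (Sym2 V))).IsAcyclic) (E.erase f) hef',
      card_filter_and_not_mem (fun G : Finset (Sym2 V) =>
        (fromEdgeSet ((insert f G : Finset (Sym2 V)) : Set (Sym2 V))).IsAcyclic) (E.erase f) e, hDD]
    simp only [Finset.insert_comm f e]
  -- N
  have nn : #(E.powerset.filter fun F : Finset (Sym2 V) =>
        (fromEdgeSet ((F : Finset (Sym2 V)) : Set (Sym2 V))).IsAcyclic) =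
      (#(((E.erase e).erase f).powerset.filter fun G : Finset (Sym2 V) =>
        (fromEdgeSet ((insert e (insert f G) : Finset (Sym2 V)) : Set (Sym2 V))).IsAcyclic) +
      #(((E.erase e).erase f).powerset.filter fun G : Finset (Sym2 V) =>
        (fromEdgeSet ((insert e G : Finset (Sym2 V)) : Set (Sym2 V))).IsAcyclic)) +
      (#(((E.erase e).erase f).powerset.filter fun G : Finset (Sym2 V) =>
        (fromEdgeSet ((insert f G : Finset (Sym2 V)) : Set (Sym2 V))).IsAcyclic) +
      #(((E.erase e).erase f).powerset.filter fun G : Finset (Sym2 V) =>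
        (fromEdgeSet ((G : Finset (Sym2 V)) : Set (Sym2 V))).IsAcyclic)) := by
    rw [card_filter_split_mem _ E e, ne, card_filter_and_not_mem _ E e,
      card_filter_split_mem _ (E.erase e) f,
      card_filter_and_mem (fun G : Finset (Sym2 V) => (fromEdgeSet ((G : Finset (Sym2 V)) : Set (Sym2 V))).IsAcyclic) (E.erase e) hfe,
      card_filter_and_not_mem (fun G : Finset (Sym2 V) => (fromEdgeSet ((G : Finset (Sym2 V)) : Set (Sym2 V))).IsAcyclic) (E.erase e) f]
  -- the unit-weight Rayleigh inequality on `D`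
  have ray := hR (fun _ => (1 : ℝ)) (fun _ => zero_le_one)
    ((E.erase e).erase f) ∅ e f
    (by
      intro x hx
      rcases Finset.mem_union.1 hx with hx | hx
      · exact hE (Finset.mem_of_mem_erase (Finset.mem_of_mem_erase hx))
      · simp only [Finset.mem_insert, Finset.notMem_empty, or_false] at hx
        rcases hx with rfl | rfl
        · exact hE he
        · exact hE hf)
    (Finset.disjoint_empty_right _) heD (Finset.notMem_empty _) hfD (Finset.notMem_empty _) hef
  simp only [Finset.prod_const_one, Finset.sum_const, nsmul_eq_mul, mul_one, Finset.union_insert,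
    Finset.union_empty] at ray
  rw [nef, ne, nf, nn]
  refine negCorr_of_rayleigh_counts ?_
  exact_mod_cast ray


end Summit.CriticalPhenomena.PercolationContinuityZ3.Theorems.ForestRayleigh
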